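import Literature.NumberTheory.Automorphic.ArchRankinSelbergTorusReductionGL2
import Literature.NumberTheory.Automorphic.ArchRankinSelbergTestFunctionGL2
import HarnessLib

/-!
# Humphries–Jo's archimedean test vector theorem in rank two: reduction of clause (i) to the
# `K_∞`-average Gamma identity (Humphries–Jo (2024), Prop. 5.2 ⟹ Thm. 5.6 at `n = 2`)

Topic `NumberTheory/Automorphic`; namespace `Literature.NumberTheory.Automorphic`. Theorems only (no
definition, no named fact, no instance). Proof file under the named fact
`HumphriesJo2024_archRankinSelberg_testVector` (`ArchRankinSelbergTestVector`), rank `2`. Clause (ii)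
of the fact is proved (`HumphriesJo2024_archRankinSelberg_testVector_two_integrable`); clause (i) — ONE
triple (`e`, `e'`, `Φ_∞`) of `K_∞`-finite Gårding vectors and a polynomial-times-Gaussian with
`Ψ_∞(s; W_e, W̄'_{e'}, Φ_∞) = c^s ∏ Γ_ℝ(s + a_j) ∏ Γ_ℂ(s + b_j)` on `re s > 1` — is here REDUCED, by the torus
reduction (`ArchRankinSelbergTorusReductionGL2`) and the factorising test functions
(`ArchRankinSelbergTestFunctionGL2`), to the following statement about Kirillov functions ALONE, the
rank-two content of Humphries–Jo (2024), Prop. 5.2 and Thm. 5.6 (spelled out as the hypothesis `h` of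
`HumphriesJo2024_archRankinSelberg_testVector_two_gammaIdentity_of_kAverage`; NOT proved in the tree):

  for irreducible unitary `τ, τ'` on `GL₂(K_∞)` with central characters `ω, ω'` and non-zero continuous
  `ψ_∞`-Whittaker functionals `ℓ, ℓ'`, and Haar measures `μ_K, μ₁, μ_c` on `K_∞`, `K_∞ˣ`, `K_∞ˣ`, there are
  `K_∞`-finite Gårding `e, e'`, a polynomial `P` on `K_∞²` homogeneous of degree character `χ`
  (`P(c · x) = χ(c) P(x)`), `c > 0` and shifts of real part `> -1` with, for `re s > 1`,
  `(∫ ω conj ω'(c) χ(c) e^{-π Σ_w |c_w|²} N(c)^{2s} dμ_c) ·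
     ∫ (∫_{K_∞} P(e₂ k) W_{τ(k)e}(a(t)) conj W'_{τ'(k)e'}(a(t)) dμ_K) N(t)^{s-1} dμ₁(t)
       = c^s ∏_j Γ_ℝ(s + a_j) ∏_j Γ_ℂ(s + b_j)`

— the product of Tate's factor (`ArchRankinSelbergTateFactorGL2`, once the integrand is radial,
`ArchRankinSelbergKAverageGL2`) and the Mellin transform of the `K_∞`-average of the product of the two
Kirillov functions (Humphries–Jo: `L(ns, ω_{π_ur} ω_{σ_ur}) · ∫ W°_π (h 1) W°_σ (h 1) |det h|^{s-1} dh
= L(s, π_ur × σ_ur)`; the local integrals of the tree's test vectors are in `KirillovShapeProductMellinGL2`).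
Given `h`, clause (i) follows (`…_gammaIdentity_of_kAverage`) with `Φ_∞ = P · (standard Gaussian)` and `e`
rescaled by the Haar constant `κ` of `μ_A = κ (μ₁ × μ_c)_*`; with clause (ii) this gives the whole fact
(`HumphriesJo2024_archRankinSelberg_testVector_two_of_kAverage`).

## References

* P. Humphries, Y. Jo, *Test vectors for archimedean period integrals*, Publ. Mat. 68 (2024), Thm. 1.1,
  §5 Prop. 5.2, Thm. 5.6 [HumphriesJo2024].
* H. Jacquet, *Automorphic Forms on GL(2), Part II*, LNM 278 (1972), §17–§19 [Jacquet1972GL2II].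
-/

noncomputable section

open MeasureTheory Measure NumberField NumberField.mixedEmbedding NumberField.InfinitePlace IsDedekindDomain Set Filter
open scoped MatrixGroups ENNReal NNReal Classical ComplexConjugate

namespace Literature.NumberTheory.Automorphic

-- as in `ArchGardingWhittaker` / `ArchRankinSelbergIntegrableGL2`
set_option backward.isDefEq.respectTransparency false

variable (K : Type) [Field K] [NumberField K]

set_option maxHeartbeats 4000000 in
/-- **Clause (i) of `HumphriesJo2024_archRankinSelberg_testVector 2 K` from the `K_∞`-average Gamma identity.**
If for all irreducible unitary `τ, τ'` on `GL₂(K_∞)` with central characters `ω, ω'`, non-zero continuous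
Whittaker functionals and Haar measures `μ_K, μ₁, μ_c` there are `K_∞`-finite Gårding `e, e'`, a homogeneous
polynomial `P` on `K_∞²` (degree character `χ`), `c > 0` and shifts of real part `> -1` with
`(∫ ω conj ω' χ e^{-π Σ|c_w|²} N^{2s} dμ_c) · ∫ (∫_{K_∞} P(e₂k) W_{τ(k)e} conj W'_{τ'(k)e'} dμ_K)(a(t)) N(t)^{s-1} dμ₁
= c^s ∏ Γ_ℝ(s + a_j) ∏ Γ_ℂ(s + b_j)` for `re s > 1` (hypothesis `h`: Humphries–Jo (2024), Prop. 5.2 with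
Thm. 5.6 at `n = 2`, NOT proved in the tree), then clause (i) of the fact holds: take
`Φ_∞ = P · exp(-π Σ_j Σ_w |x_{j,w}|²)` (`exists_isArchPolyGaussian_factor`), reduce `Ψ_∞` to the torus
(`archRankinSelbergPairIntegralCplx_two_eq_torus`, the integrability being clause (ii)) and rescale `e` by
the Haar constant. [cite: HumphriesJo2024, Thm. 1.1, Prop. 5.2, Thm. 5.6 (pp. 140, 151–153)] -/
theorem HumphriesJo2024_archRankinSelberg_testVector_two_gammaIdentity_of_kAverage
    (h : ∀ (hcpt : isCompact_glFiniteIntegralLevel 2 K)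
      (E : Type) [NormedAddCommGroup E] [InnerProductSpace ℂ E] [CompleteSpace E]
      (τ : ContRepresentation ℂ (AutomorphyDatum.gl 2 K hcpt).arch.carrier E) (hτ : τ.IsStronglyContinuous)
      (_ : τ.IsUnitary) (_ : τ.IsTopIrreducible)
      (ℓ : archGardingSpace hcpt τ →ₗ[ℂ] ℂ) (_ : IsArchContWhittakerFunctional hcpt τ hτ ℓ) (_ : ℓ ≠ 0)
      (E' : Type) [NormedAddCommGroup E'] [InnerProductSpace ℂ E'] [CompleteSpace E']
      (τ' : ContRepresentation ℂ (AutomorphyDatum.gl 2 K hcpt).arch.carrier E') (hτ' : τ'.IsStronglyContinuous)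
      (_ : τ'.IsUnitary) (_ : τ'.IsTopIrreducible)
      (ℓ' : archGardingSpace hcpt τ' →ₗ[ℂ] ℂ) (_ : IsArchContWhittakerFunctional hcpt τ' hτ' ℓ') (_ : ℓ' ≠ 0)
      (ω ω' : (mixedSpace K)ˣ → ℂ) (_ : ∀ c, ‖ω c‖ = 1) (_ : ∀ c, ‖ω' c‖ = 1)
      (_ : ∀ (c : (mixedSpace K)ˣ) (v : E), τ (toArch hcpt (glDiagonal 2 (mixedSpace K) fun _ => c)) v = ω c • v)
      (_ : ∀ (c : (mixedSpace K)ˣ) (v : E'), τ' (toArch hcpt (glDiagonal 2 (mixedSpace K) fun _ => c)) v = ω' c • v)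
      [MeasurableSpace (GL (Fin 2) (mixedSpace K))] [BorelSpace (GL (Fin 2) (mixedSpace K))]
      [MeasurableSpace ((mixedSpace K)ˣ)] [BorelSpace ((mixedSpace K)ˣ)]
      (μK : Measure ↥(Kinf 2 K)) (_ : IsHaarMeasure μK)
      (μA' : Measure (Fin 1 → (mixedSpace K)ˣ)) (_ : IsHaarMeasure μA') (μc : Measure (mixedSpace K)ˣ) (_ : IsHaarMeasure μc),
      ∃ (e : archGardingSpace hcpt τ) (e' : archGardingSpace hcpt τ')
        (_ : FiniteDimensional ℂ (Submodule.span ℂ (Set.range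
          fun κ : (AutomorphyDatum.gl 2 K hcpt).arch.maximalCompact => τ (toArch hcpt (κ : GL (Fin 2) (mixedSpace K))) (e : E))))
        (_ : FiniteDimensional ℂ (Submodule.span ℂ (Set.range
          fun κ : (AutomorphyDatum.gl 2 K hcpt).arch.maximalCompact => τ' (toArch hcpt (κ : GL (Fin 2) (mixedSpace K))) (e' : E'))))
        (P : (Fin 2 → mixedSpace K) → ℂ) (χ : (mixedSpace K)ˣ → ℂ)
        (_ : ∃ (N : ℕ) (L : Fin N → ((Fin 2 → mixedSpace K) →L[ℝ] ℝ)) (q : MvPolynomial (Fin N) ℂ),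
          ∀ x, P x = MvPolynomial.eval (fun i => ((L i x : ℝ) : ℂ)) q)
        (_ : ∀ (c : (mixedSpace K)ˣ) (x : Fin 2 → mixedSpace K), P (fun j => (c : mixedSpace K) * x j) = χ c * P x)
        (c : ℝ) (_ : 0 < c) (d₁ d₂ : ℕ) (a : Fin d₁ → ℂ) (b : Fin d₂ → ℂ)
        (_ : ∀ j, -1 < (a j).re) (_ : ∀ j, -1 < (b j).re),
        ∀ s : ℂ, 1 < s.re →
          (∫ cc, ω cc * conj (ω' cc) * (χ cc *
              (Real.exp (-(Real.pi * ((∑ w, (((cc : (mixedSpace K)ˣ) : mixedSpace K).1 w) ^ 2) +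
                ∑ w, ‖((cc : (mixedSpace K)ˣ) : mixedSpace K).2 w‖ ^ 2))) : ℂ)) *
              ((mixedEmbedding.norm ((cc : (mixedSpace K)ˣ) : mixedSpace K) : ℝ) : ℂ) ^ (2 * s) ∂μc) *
          ∫ y' : Fin 1 → (mixedSpace K)ˣ, (∫ k : ↥(Kinf 2 K),
              P (fun j => ((k : GL (Fin 2) (mixedSpace K)) : Matrix (Fin 2) (Fin 2) (mixedSpace K)) (Fin.last 1) j) *
              (kirillovFn hτ ℓ ⟨τ (toArch hcpt (k : GL (Fin 2) (mixedSpace K))) (e : E), apply_mem_archGardingSpace hτ _ e.2⟩ (y' 0) *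
                conj (kirillovFn hτ' ℓ' ⟨τ' (toArch hcpt (k : GL (Fin 2) (mixedSpace K))) (e' : E'),
                  apply_mem_archGardingSpace hτ' _ e'.2⟩ (y' 0))) ∂μK) *
            ((mixedEmbedding.norm ((y' 0 : (mixedSpace K)ˣ) : mixedSpace K) : ℝ) : ℂ) ^ (s - 1) ∂μA' =
          (c : ℂ) ^ s * ((∏ j, Complex.Gammaℝ (s + a j)) * ∏ j, Complex.Gammaℂ (s + b j)))
    (hcpt : isCompact_glFiniteIntegralLevel 2 K)
    (E : Type) [NormedAddCommGroup E] [InnerProductSpace ℂ E] [CompleteSpace E]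
    (τ : ContRepresentation ℂ (AutomorphyDatum.gl 2 K hcpt).arch.carrier E) (hτ : τ.IsStronglyContinuous)
    (hτu : τ.IsUnitary) (hτi : τ.IsTopIrreducible)
    (ℓ : archGardingSpace hcpt τ →ₗ[ℂ] ℂ) (hℓ : IsArchContWhittakerFunctional hcpt τ hτ ℓ) (hℓ0 : ℓ ≠ 0)
    (E' : Type) [NormedAddCommGroup E'] [InnerProductSpace ℂ E'] [CompleteSpace E']
    (τ' : ContRepresentation ℂ (AutomorphyDatum.gl 2 K hcpt).arch.carrier E') (hτ' : τ'.IsStronglyContinuous)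
    (hτu' : τ'.IsUnitary) (hτi' : τ'.IsTopIrreducible)
    (ℓ' : archGardingSpace hcpt τ' →ₗ[ℂ] ℂ) (hℓ' : IsArchContWhittakerFunctional hcpt τ' hτ' ℓ') (hℓ'0 : ℓ' ≠ 0)
    [MeasurableSpace (GL (Fin 2) (mixedSpace K))] [BorelSpace (GL (Fin 2) (mixedSpace K))]
    [MeasurableSpace ((mixedSpace K)ˣ)] [BorelSpace ((mixedSpace K)ˣ)]
    (μA : Measure (Fin 2 → (mixedSpace K)ˣ)) (hμA : IsHaarMeasure μA)
    (μK : Measure ↥(Kinf 2 K)) (hμK : IsHaarMeasure μK) :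
    ∃ (e : archGardingSpace hcpt τ) (e' : archGardingSpace hcpt τ')
      (_ : FiniteDimensional ℂ (Submodule.span ℂ (Set.range
        fun κ : (AutomorphyDatum.gl 2 K hcpt).arch.maximalCompact => τ (toArch hcpt (κ : GL (Fin 2) (mixedSpace K))) (e : E))))
      (_ : FiniteDimensional ℂ (Submodule.span ℂ (Set.range
        fun κ : (AutomorphyDatum.gl 2 K hcpt).arch.maximalCompact => τ' (toArch hcpt (κ : GL (Fin 2) (mixedSpace K))) (e' : E'))))
      (Φinf : (Fin 2 → InfiniteAdeleRing K) → ℂ) (_ : IsArchPolyGaussian 2 K Φinf)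
      (c : ℝ) (_ : 0 < c) (d₁ d₂ : ℕ) (a : Fin d₁ → ℂ) (b : Fin d₂ → ℂ)
      (_ : ∀ j, -1 < (a j).re) (_ : ∀ j, -1 < (b j).re),
      ∀ s : ℂ, 1 < s.re →
        archRankinSelbergPairIntegralCplx hcpt τ hτ τ' hτ' ℓ ℓ' e e' Φinf μA μK s =
          (c : ℂ) ^ s * ((∏ j, Complex.Gammaℝ (s + a j)) * ∏ j, Complex.Gammaℂ (s + b j)) := by
  haveI := hμA
  haveI := hμK
  haveI : BorelSpace (Fin 1 → (mixedSpace K)ˣ) := Pi.borelSpace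
  haveI : CompactSpace ↥(Kinf 2 K) := isCompact_iff_compactSpace.mp (isCompact_Kinf_holds 2 K)
  -- central characters and auxiliary Haar measures
  obtain ⟨ω, hω⟩ := exists_apply_glDiagonal_const_eq_smul (n := 1) (hcpt := hcpt) (τ := τ) hτu hτi
  obtain ⟨ω', hω'⟩ := exists_apply_glDiagonal_const_eq_smul (n := 1) (hcpt := hcpt) (τ := τ') hτu' hτi'
  set μc : Measure (mixedSpace K)ˣ := Measure.haar with hμc
  set μA' : Measure (Fin 1 → (mixedSpace K)ˣ) := Measure.haar with hμA'
  obtain ⟨κ, hκT, hμAeq⟩ := exists_eq_smul_map_snoc_mul (n := 1) (K := K) μA μA' μc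
  have hκ0 : κ ≠ 0 := by
    intro h0
    rw [h0, zero_smul] at hμAeq
    have hpos := IsOpenPosMeasure.open_pos (μ := μA) _ isOpen_univ univ_nonempty
    rw [hμAeq] at hpos
    exact hpos rfl
  have hκpos : 0 < κ.toReal := ENNReal.toReal_pos hκ0 hκT
  -- the data of the hypothesis
  obtain ⟨e, e', he, he', P, χ, hPpoly, hPhom, c, hc, d₁, d₂, a, b, ha, hb, hid⟩ :=
    h hcpt E τ hτ hτu hτi ℓ hℓ hℓ0 E' τ' hτ' hτu' hτi' ℓ' hℓ' hℓ'0 ω ω' (fun c => (hω c).1) (fun c => (hω' c).1)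
      (fun c v => (hω c).2 v) (fun c v => (hω' c).2 v) μK ‹_› μA' inferInstance μc inferInstance
  -- the test function
  obtain ⟨Φ, hΦpg, -, hΦfac⟩ := exists_isArchPolyGaussian_factor K P χ hPpoly hPhom
  -- the rescaled vector
  set α : ℂ := (((κ.toReal)⁻¹ : ℝ) : ℂ) with hα
  set e₁ : archGardingSpace hcpt τ := α • e with he₁
  have he₁fin : FiniteDimensional ℂ (Submodule.span ℂ (Set.range
      fun k : (AutomorphyDatum.gl 2 K hcpt).arch.maximalCompact => τ (toArch hcpt (k : GL (Fin 2) (mixedSpace K))) (e₁ : E))) := by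
    haveI := he
    have hle : Submodule.span ℂ (Set.range
        fun k : (AutomorphyDatum.gl 2 K hcpt).arch.maximalCompact => τ (toArch hcpt (k : GL (Fin 2) (mixedSpace K))) (e₁ : E)) ≤
        Submodule.span ℂ (Set.range
          fun k : (AutomorphyDatum.gl 2 K hcpt).arch.maximalCompact => τ (toArch hcpt (k : GL (Fin 2) (mixedSpace K))) (e : E)) := by
      refine Submodule.span_le.mpr ?_
      rintro _ ⟨k, rfl⟩
      change τ (toArch hcpt (k : GL (Fin 2) (mixedSpace K))) ((α • e : archGardingSpace hcpt τ) : E) ∈ _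
      rw [Submodule.coe_smul, map_smul]
      exact Submodule.smul_mem _ _ (Submodule.subset_span ⟨k, rfl⟩)
    exact Submodule.finiteDimensional_of_le hle
  refine ⟨e₁, e', he₁fin, he', Φ, hΦpg, c, hc, d₁, d₂, a, b, ha, hb, fun s hs => ?_⟩
  -- the torus reduction for `e₁`
  have hint := HumphriesJo2024_archRankinSelberg_testVector_two_integrable K hcpt E τ hτ hτu hτi ℓ hℓ E' τ' hτ' hτu' hτi'
    ℓ' hℓ' μA ‹_› μK ‹_› e₁ e' he₁fin he' Φ hΦpg s hs
  rw [archRankinSelbergPairIntegralCplx_two_eq_torus hcpt τ hτ τ' hτ' ℓ ℓ' e₁ e' (fun c v => (hω c).2 v) (fun c v => (hω' c).2 v)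
    Φ (g := fun cc => χ cc * (Real.exp (-(Real.pi * ((∑ w, (((cc : (mixedSpace K)ˣ) : mixedSpace K).1 w) ^ 2) +
      ∑ w, ‖((cc : (mixedSpace K)ˣ) : mixedSpace K).2 w‖ ^ 2))) : ℂ))
    (Pk := fun k => P (fun j => (k : Matrix (Fin 2) (Fin 2) (mixedSpace K)) (Fin.last 1) j))
    hΦfac μA μK μA' μc κ hμAeq s hint]
  -- the Kirillov function of `τ(k) e₁` is `α` times that of `τ(k) e`
  have hkir : ∀ (k : ↥(Kinf 2 K)) (u : (mixedSpace K)ˣ),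
      kirillovFn hτ ℓ ⟨τ (toArch hcpt (k : GL (Fin 2) (mixedSpace K))) (e₁ : E), apply_mem_archGardingSpace hτ _ e₁.2⟩ u =
        α * kirillovFn hτ ℓ ⟨τ (toArch hcpt (k : GL (Fin 2) (mixedSpace K))) (e : E), apply_mem_archGardingSpace hτ _ e.2⟩ u := by
    intro k u
    have hv : (⟨τ (toArch hcpt (k : GL (Fin 2) (mixedSpace K))) (e₁ : E), apply_mem_archGardingSpace hτ _ e₁.2⟩ : archGardingSpace hcpt τ) =
        α • ⟨τ (toArch hcpt (k : GL (Fin 2) (mixedSpace K))) (e : E), apply_mem_archGardingSpace hτ _ e.2⟩ := by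
      refine Subtype.ext ?_
      change τ (toArch hcpt (k : GL (Fin 2) (mixedSpace K))) ((α • e : archGardingSpace hcpt τ) : E) = α • τ (toArch hcpt (k : GL (Fin 2) (mixedSpace K))) (e : E)
      rw [Submodule.coe_smul, map_smul]
    rw [hv, kirillovFn_smul, Pi.smul_apply, smul_eq_mul]
  have hinner : ∀ y' : Fin 1 → (mixedSpace K)ˣ,
      ∫ k : ↥(Kinf 2 K), P (fun j => ((k : GL (Fin 2) (mixedSpace K)) : Matrix (Fin 2) (Fin 2) (mixedSpace K)) (Fin.last 1) j) *
          (kirillovFn hτ ℓ ⟨τ (toArch hcpt (k : GL (Fin 2) (mixedSpace K))) (e₁ : E), apply_mem_archGardingSpace hτ _ e₁.2⟩ (y' 0) *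
            conj (kirillovFn hτ' ℓ' ⟨τ' (toArch hcpt (k : GL (Fin 2) (mixedSpace K))) (e' : E'),
              apply_mem_archGardingSpace hτ' _ e'.2⟩ (y' 0))) ∂μK =
        α * ∫ k : ↥(Kinf 2 K), P (fun j => ((k : GL (Fin 2) (mixedSpace K)) : Matrix (Fin 2) (Fin 2) (mixedSpace K)) (Fin.last 1) j) *
          (kirillovFn hτ ℓ ⟨τ (toArch hcpt (k : GL (Fin 2) (mixedSpace K))) (e : E), apply_mem_archGardingSpace hτ _ e.2⟩ (y' 0) *
            conj (kirillovFn hτ' ℓ' ⟨τ' (toArch hcpt (k : GL (Fin 2) (mixedSpace K))) (e' : E'),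
              apply_mem_archGardingSpace hτ' _ e'.2⟩ (y' 0))) ∂μK := by
    intro y'
    rw [← integral_const_mul]
    refine integral_congr_ae (Eventually.of_forall fun k => ?_)
    simp only [hkir]
    ring
  simp_rw [hinner]
  have hpull : ∫ y' : Fin 1 → (mixedSpace K)ˣ, α * (∫ k : ↥(Kinf 2 K),
        P (fun j => ((k : GL (Fin 2) (mixedSpace K)) : Matrix (Fin 2) (Fin 2) (mixedSpace K)) (Fin.last 1) j) *
          (kirillovFn hτ ℓ ⟨τ (toArch hcpt (k : GL (Fin 2) (mixedSpace K))) (e : E), apply_mem_archGardingSpace hτ _ e.2⟩ (y' 0) *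
            conj (kirillovFn hτ' ℓ' ⟨τ' (toArch hcpt (k : GL (Fin 2) (mixedSpace K))) (e' : E'),
              apply_mem_archGardingSpace hτ' _ e'.2⟩ (y' 0))) ∂μK) *
        ((mixedEmbedding.norm ((y' 0 : (mixedSpace K)ˣ) : mixedSpace K) : ℝ) : ℂ) ^ (s - 1) ∂μA' =
      α * ∫ y' : Fin 1 → (mixedSpace K)ˣ, (∫ k : ↥(Kinf 2 K),
        P (fun j => ((k : GL (Fin 2) (mixedSpace K)) : Matrix (Fin 2) (Fin 2) (mixedSpace K)) (Fin.last 1) j) *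
          (kirillovFn hτ ℓ ⟨τ (toArch hcpt (k : GL (Fin 2) (mixedSpace K))) (e : E), apply_mem_archGardingSpace hτ _ e.2⟩ (y' 0) *
            conj (kirillovFn hτ' ℓ' ⟨τ' (toArch hcpt (k : GL (Fin 2) (mixedSpace K))) (e' : E'),
              apply_mem_archGardingSpace hτ' _ e'.2⟩ (y' 0))) ∂μK) *
        ((mixedEmbedding.norm ((y' 0 : (mixedSpace K)ˣ) : mixedSpace K) : ℝ) : ℂ) ^ (s - 1) ∂μA' := by
    rw [← integral_const_mul]
    refine integral_congr_ae (Eventually.of_forall fun y' => ?_)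
    ring
  rw [hpull]
  have hprod := hid s hs
  have hακ : (κ.toReal : ℂ) * α = 1 := by
    rw [hα, Complex.ofReal_inv, mul_inv_cancel₀]
    exact_mod_cast hκpos.ne'
  calc (κ.toReal : ℂ) *
        (∫ cc, ω cc * conj (ω' cc) * (χ cc *
            (Real.exp (-(Real.pi * ((∑ w, (((cc : (mixedSpace K)ˣ) : mixedSpace K).1 w) ^ 2) +
              ∑ w, ‖((cc : (mixedSpace K)ˣ) : mixedSpace K).2 w‖ ^ 2))) : ℂ)) *
            ((mixedEmbedding.norm ((cc : (mixedSpace K)ˣ) : mixedSpace K) : ℝ) : ℂ) ^ (2 * s) ∂μc) *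
        (α * ∫ y' : Fin 1 → (mixedSpace K)ˣ, (∫ k : ↥(Kinf 2 K),
            P (fun j => ((k : GL (Fin 2) (mixedSpace K)) : Matrix (Fin 2) (Fin 2) (mixedSpace K)) (Fin.last 1) j) *
              (kirillovFn hτ ℓ ⟨τ (toArch hcpt (k : GL (Fin 2) (mixedSpace K))) (e : E), apply_mem_archGardingSpace hτ _ e.2⟩ (y' 0) *
                conj (kirillovFn hτ' ℓ' ⟨τ' (toArch hcpt (k : GL (Fin 2) (mixedSpace K))) (e' : E'),
                  apply_mem_archGardingSpace hτ' _ e'.2⟩ (y' 0))) ∂μK) *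
            ((mixedEmbedding.norm ((y' 0 : (mixedSpace K)ˣ) : mixedSpace K) : ℝ) : ℂ) ^ (s - 1) ∂μA')
      = ((κ.toReal : ℂ) * α) *
          ((∫ cc, ω cc * conj (ω' cc) * (χ cc *
              (Real.exp (-(Real.pi * ((∑ w, (((cc : (mixedSpace K)ˣ) : mixedSpace K).1 w) ^ 2) +
                ∑ w, ‖((cc : (mixedSpace K)ˣ) : mixedSpace K).2 w‖ ^ 2))) : ℂ)) *
              ((mixedEmbedding.norm ((cc : (mixedSpace K)ˣ) : mixedSpace K) : ℝ) : ℂ) ^ (2 * s) ∂μc) *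
            ∫ y' : Fin 1 → (mixedSpace K)ˣ, (∫ k : ↥(Kinf 2 K),
              P (fun j => ((k : GL (Fin 2) (mixedSpace K)) : Matrix (Fin 2) (Fin 2) (mixedSpace K)) (Fin.last 1) j) *
                (kirillovFn hτ ℓ ⟨τ (toArch hcpt (k : GL (Fin 2) (mixedSpace K))) (e : E), apply_mem_archGardingSpace hτ _ e.2⟩ (y' 0) *
                  conj (kirillovFn hτ' ℓ' ⟨τ' (toArch hcpt (k : GL (Fin 2) (mixedSpace K))) (e' : E'),
                    apply_mem_archGardingSpace hτ' _ e'.2⟩ (y' 0))) ∂μK) *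
              ((mixedEmbedding.norm ((y' 0 : (mixedSpace K)ˣ) : mixedSpace K) : ℝ) : ℂ) ^ (s - 1) ∂μA') := by ring
    _ = (c : ℂ) ^ s * ((∏ j, Complex.Gammaℝ (s + a j)) * ∏ j, Complex.Gammaℂ (s + b j)) := by
        rw [hακ, one_mul, hprod]

/-- **The rank-two fact from the `K_∞`-average Gamma identity**: `HumphriesJo2024_archRankinSelberg_testVector 2 K`
follows from the hypothesis `h` of `HumphriesJo2024_archRankinSelberg_testVector_two_gammaIdentity_of_kAverage`
(Humphries–Jo (2024), Prop. 5.2 with Thm. 5.6 at `n = 2`, NOT proved in the tree), clause (ii) being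
`HumphriesJo2024_archRankinSelberg_testVector_two_integrable`.
[cite: HumphriesJo2024, Thm. 1.1, Prop. 5.2, Thm. 5.6 (pp. 140, 151–153)] -/
theorem HumphriesJo2024_archRankinSelberg_testVector_two_of_kAverage
    (h : ∀ (hcpt : isCompact_glFiniteIntegralLevel 2 K)
      (E : Type) [NormedAddCommGroup E] [InnerProductSpace ℂ E] [CompleteSpace E]
      (τ : ContRepresentation ℂ (AutomorphyDatum.gl 2 K hcpt).arch.carrier E) (hτ : τ.IsStronglyContinuous)
      (_ : τ.IsUnitary) (_ : τ.IsTopIrreducible)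
      (ℓ : archGardingSpace hcpt τ →ₗ[ℂ] ℂ) (_ : IsArchContWhittakerFunctional hcpt τ hτ ℓ) (_ : ℓ ≠ 0)
      (E' : Type) [NormedAddCommGroup E'] [InnerProductSpace ℂ E'] [CompleteSpace E']
      (τ' : ContRepresentation ℂ (AutomorphyDatum.gl 2 K hcpt).arch.carrier E') (hτ' : τ'.IsStronglyContinuous)
      (_ : τ'.IsUnitary) (_ : τ'.IsTopIrreducible)
      (ℓ' : archGardingSpace hcpt τ' →ₗ[ℂ] ℂ) (_ : IsArchContWhittakerFunctional hcpt τ' hτ' ℓ') (_ : ℓ' ≠ 0)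
      (ω ω' : (mixedSpace K)ˣ → ℂ) (_ : ∀ c, ‖ω c‖ = 1) (_ : ∀ c, ‖ω' c‖ = 1)
      (_ : ∀ (c : (mixedSpace K)ˣ) (v : E), τ (toArch hcpt (glDiagonal 2 (mixedSpace K) fun _ => c)) v = ω c • v)
      (_ : ∀ (c : (mixedSpace K)ˣ) (v : E'), τ' (toArch hcpt (glDiagonal 2 (mixedSpace K) fun _ => c)) v = ω' c • v)
      [MeasurableSpace (GL (Fin 2) (mixedSpace K))] [BorelSpace (GL (Fin 2) (mixedSpace K))]
      [MeasurableSpace ((mixedSpace K)ˣ)] [BorelSpace ((mixedSpace K)ˣ)]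
      (μK : Measure ↥(Kinf 2 K)) (_ : IsHaarMeasure μK)
      (μA' : Measure (Fin 1 → (mixedSpace K)ˣ)) (_ : IsHaarMeasure μA') (μc : Measure (mixedSpace K)ˣ) (_ : IsHaarMeasure μc),
      ∃ (e : archGardingSpace hcpt τ) (e' : archGardingSpace hcpt τ')
        (_ : FiniteDimensional ℂ (Submodule.span ℂ (Set.range
          fun κ : (AutomorphyDatum.gl 2 K hcpt).arch.maximalCompact => τ (toArch hcpt (κ : GL (Fin 2) (mixedSpace K))) (e : E))))
        (_ : FiniteDimensional ℂ (Submodule.span ℂ (Set.range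
          fun κ : (AutomorphyDatum.gl 2 K hcpt).arch.maximalCompact => τ' (toArch hcpt (κ : GL (Fin 2) (mixedSpace K))) (e' : E'))))
        (P : (Fin 2 → mixedSpace K) → ℂ) (χ : (mixedSpace K)ˣ → ℂ)
        (_ : ∃ (N : ℕ) (L : Fin N → ((Fin 2 → mixedSpace K) →L[ℝ] ℝ)) (q : MvPolynomial (Fin N) ℂ),
          ∀ x, P x = MvPolynomial.eval (fun i => ((L i x : ℝ) : ℂ)) q)
        (_ : ∀ (c : (mixedSpace K)ˣ) (x : Fin 2 → mixedSpace K), P (fun j => (c : mixedSpace K) * x j) = χ c * P x)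
        (c : ℝ) (_ : 0 < c) (d₁ d₂ : ℕ) (a : Fin d₁ → ℂ) (b : Fin d₂ → ℂ)
        (_ : ∀ j, -1 < (a j).re) (_ : ∀ j, -1 < (b j).re),
        ∀ s : ℂ, 1 < s.re →
          (∫ cc, ω cc * conj (ω' cc) * (χ cc *
              (Real.exp (-(Real.pi * ((∑ w, (((cc : (mixedSpace K)ˣ) : mixedSpace K).1 w) ^ 2) +
                ∑ w, ‖((cc : (mixedSpace K)ˣ) : mixedSpace K).2 w‖ ^ 2))) : ℂ)) *
              ((mixedEmbedding.norm ((cc : (mixedSpace K)ˣ) : mixedSpace K) : ℝ) : ℂ) ^ (2 * s) ∂μc) *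
          ∫ y' : Fin 1 → (mixedSpace K)ˣ, (∫ k : ↥(Kinf 2 K),
              P (fun j => ((k : GL (Fin 2) (mixedSpace K)) : Matrix (Fin 2) (Fin 2) (mixedSpace K)) (Fin.last 1) j) *
              (kirillovFn hτ ℓ ⟨τ (toArch hcpt (k : GL (Fin 2) (mixedSpace K))) (e : E), apply_mem_archGardingSpace hτ _ e.2⟩ (y' 0) *
                conj (kirillovFn hτ' ℓ' ⟨τ' (toArch hcpt (k : GL (Fin 2) (mixedSpace K))) (e' : E'),
                  apply_mem_archGardingSpace hτ' _ e'.2⟩ (y' 0))) ∂μK) *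
            ((mixedEmbedding.norm ((y' 0 : (mixedSpace K)ˣ) : mixedSpace K) : ℝ) : ℂ) ^ (s - 1) ∂μA' =
          (c : ℂ) ^ s * ((∏ j, Complex.Gammaℝ (s + a j)) * ∏ j, Complex.Gammaℂ (s + b j))) :
    HumphriesJo2024_archRankinSelberg_testVector 2 K :=
  HumphriesJo2024_archRankinSelberg_testVector_two_of_gammaIdentity K
    (HumphriesJo2024_archRankinSelberg_testVector_two_gammaIdentity_of_kAverage K h)

end Literature.NumberTheory.Automorphic
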